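import Literature.IUT.LogThetaLattice.DHodgeTheaterGroupoid

/-!
# [IUTchI] Def 6.4 (iii): every printed isomorphism of `𝒟-Θ^{±ell}`-Hodge theaters has a representative — PROOF companion

Mochizuki, *Inter-universal Teichmüller Theory I*, kurims manuscript (May 2020), §6, Def 6.4 (i)–(iii)
pp. 162–163 ([IUTchI] Def 6.4 (iii) p.163) [claim: Mochizuki2012, status: disputed]; *III*, Rmk 1.3.1 p. 43.
Proof-only companion (abc-iut cell, wave-4 seat abc-iut-w4-d045; no definitions) to abc-iut-L6-t3's
`DHodgeTheaterRepIso.lean` / `DHodgeTheaterGroupoid.lean`, closing the audit note of 2026-08-25 on p411596: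
the representative-level groupoid `DHTRep K` is FAITHFUL to the printed poly-level notion in BOTH directions.

* `DHodgeTheaterGroupoid.lean` proves that every representative `f : DRepIso H₁ H₂` DETERMINES a printed
  (poly-level) isomorphism `f.toIso : DThetaPMEllHT.Iso H₁ H₂` (abc-iut-L5-t4's record of Def 6.4 (iii)).
* Here: `DRepIso.toIso_surjective` — conversely EVERY printed isomorphism of `𝒟-Θ^{±ell}`-Hodge theaters is
  `f.toIso` for some representative `f` (choose one constituent of each `+`-full orbit and of the
  `Aut_csp(‡𝒟^{⊚±})`-orbit; the printed compatibility conditions are conditions on the ORBITS, so they transfer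
  verbatim). Hence "a printed isomorphism `Ξ` = the set of its representatives" ([IUTchIII] Rmk 1.3.1: "first
  for a single `Ξ` [i.e., as opposed to a poly-isomorphism `Ξ`]") is a kernel fact: `toIso` is a surjection
  whose fibres are described by `toIso_eq_toIso_iff` (same index bijection, `†𝔇_≻ ⥲ ‡𝔇_≻` in the same
  `Aut_+`-orbit, `†𝒟^{⊚±} ⥲ ‡𝒟^{⊚±}` in the same `Aut_csp`-orbit; the capsule constituents are then forced —
  abc-iut-L5-t13's rigidity, via `toPMIso_eq_iff`).

Nothing of the series is asserted; no side is taken on [IUTchIII] Cor. 3.12; typed ≠ proved.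
-/

namespace Literature.IUT.LogThetaLattice

open CategoryTheory
open Literature.IUT.HodgeTheaters Literature.IUT.HodgeTheaters.PMBaseKit

universe u

namespace DHTRep.DRepIso

variable {l : ℕ} {K : PMBaseKit.{u} l} {H₁ H₂ : K.DThetaPMEllHT}

/-- **IUTchI:Def6.4(iii)** (kurims p.163) Extensionality for abc-iut-L5-t4's poly-level isomorphisms of
`𝒟-Θ^±`-bridges: determined by the index bijection, the capsule poly-isomorphism and the poly-isomorphism
`†𝔇_≻ ⥲ ‡𝔇_≻` (the remaining fields are propositions). [claim: Mochizuki2012, status: disputed] -/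
theorem _root_.Literature.IUT.HodgeTheaters.PMBaseKit.DThetaPMBridge.Iso.ext'
    {B₁ B₂ : K.DThetaPMBridge} {I J : DThetaPMBridge.Iso B₁ B₂} (hι : I.indexEquiv = J.indexEquiv)
    (hcaps : HEq I.capsPoly J.capsPoly) (hcod : I.codPoly = J.codPoly) : I = J := by
  obtain ⟨ι, hιc, caps, hcapsf, cod, hcodf, hcompat⟩ := I
  obtain ⟨ι', hιc', caps', hcapsf', cod', hcodf', hcompat'⟩ := J
  cases hι; cases hcod
  obtain rfl : caps = caps' := eq_of_heq hcaps
  rfl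

/-- **IUTchI:Def6.4(iii)** (kurims p.163) Extensionality for abc-iut-L5-t4's poly-level isomorphisms of
`𝒟-Θ^{ell}`-bridges: determined by the index bijection, the capsule poly-isomorphism and the poly-isomorphism
`†𝒟^{⊚±} ⥲ ‡𝒟^{⊚±}`. [claim: Mochizuki2012, status: disputed] -/
theorem _root_.Literature.IUT.HodgeTheaters.PMBaseKit.DThetaEllBridge.Iso.ext'
    {B₁ B₂ : K.DThetaEllBridge} {I J : DThetaEllBridge.Iso B₁ B₂} (hι : I.indexEquiv = J.indexEquiv)
    (hcaps : HEq I.capsPoly J.capsPoly) (hglob : I.globPoly = J.globPoly) : I = J := by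
  obtain ⟨ι, hιc, caps, hcapsf, glob, hglobf, hcompat⟩ := I
  obtain ⟨ι', hιc', caps', hcapsf', glob', hglobf', hcompat'⟩ := J
  cases hι; cases hglob
  obtain rfl : caps = caps' := eq_of_heq hcaps
  rfl

/-- **IUTchI:Def6.4(iii)** (kurims p.163) Extensionality for printed isomorphisms of `𝒟-Θ^{±ell}`-Hodge
theaters: the pair of bridge isomorphisms determines it. [claim: Mochizuki2012, status: disputed] -/
theorem _root_.Literature.IUT.HodgeTheaters.PMBaseKit.DThetaPMEllHT.Iso.ext'
    {I J : DThetaPMEllHT.Iso H₁ H₂} (hpm : I.pmIso = J.pmIso) (hell : I.ellIso = J.ellIso) : I = J := by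
  obtain ⟨P, E, h1, h2⟩ := I
  obtain ⟨P', E', h1', h2'⟩ := J
  cases hpm; cases hell
  rfl

/-- **IUTchI:Def6.4(iii)** (kurims p.163) **Every printed isomorphism of `𝒟-Θ^{±ell}`-Hodge theaters has a
representative**: `DRepIso.toIso` is surjective onto abc-iut-L5-t4's poly-level `DThetaPMEllHT.Iso H₁ H₂`.
Choose a constituent of each capsule-`+`-full orbit ("obtained as the `Aut_+(‡𝔇)`-orbit of an isomorphism",
Def 6.1 (iv) p.157), of the `+`-full orbit `†𝔇_≻ ⥲ ‡𝔇_≻`, and of "the `Aut_csp(‡𝒟^{⊚±})`-orbit of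
isomorphisms" `†𝒟^{⊚±} ⥲ ‡𝒟^{⊚±}` (Def 6.4 (ii) p.163); the compatibility conditions of Def 6.4 (i), (ii) are
conditions on these orbits and hold verbatim for the chosen representatives; "the same poly-isomorphism
between the respective capsules" (Def 6.4 (iii)) makes ONE choice of capsule constituents serve both bridges.
[claim: Mochizuki2012, status: disputed] -/
theorem toIso_surjective : Function.Surjective (toIso : DRepIso H₁ H₂ → DThetaPMEllHT.Iso H₁ H₂) := by
  intro I
  obtain ⟨P, E, hidx, hcaps⟩ := I
  obtain ⟨ιE, ιE_charts, capsE, capsE_pf, globPoly, globPoly_orbit, compatE⟩ := E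
  -- the two index bijections coincide ("induce the same poly-isomorphism between the respective capsules")
  obtain rfl : ιE = P.indexEquiv := (Equiv.ext hidx).symm
  -- hence so do the two capsule poly-isomorphisms
  have hcapsE : capsE = P.capsPoly := by
    funext t
    ext p
    have h := hcaps t p
    dsimp only [DThetaPMEllHT.pmBridge, DThetaPMEllHT.ellBridge] at h p
    simp only [eqToIso_refl, Iso.trans_refl] at h
    exact h.symm
  subst hcapsE
  -- choose representatives of the orbits
  choose caps hcapsRep using P.capsPoly_plusFull
  obtain ⟨cod, hcod⟩ := P.codPoly_plusFull
  obtain ⟨glob, hglob⟩ := globPoly_orbit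
  have hcapsRep' : ∀ t, P.capsPoly t = DStrip.plusFullPolyIso (caps t) := hcapsRep
  have hcod' : P.codPoly = DStrip.plusFullPolyIso cod := hcod
  -- the representative
  let f : DRepIso H₁ H₂ :=
    { ι := P.indexEquiv
      ι_charts := P.indexEquiv_charts
      caps := caps
      cod := cod
      glob := glob
      compatPM := fun t => by
        have h := P.compat t
        rw [hcapsRep' t, hcod'] at h
        exact h
      compatEll := fun t v => by
        have h := compatE t v
        rw [hcapsRep' t, hglob] at h
        refine h.trans ?_
        ext k
        simp only [Set.mem_setOf_eq]
        constructor
        · rintro ⟨e, he, q, ⟨c, hc, rfl⟩, rfl⟩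
          exact ⟨e, he, c, hc, rfl⟩
        · rintro ⟨e, he, c, hc, rfl⟩
          exact ⟨e, he, _, ⟨c, hc, rfl⟩, rfl⟩ }
  have hcapsF : (fun t => DStrip.plusFullPolyIso (caps t)) = P.capsPoly := funext fun t => (hcapsRep' t).symm
  refine ⟨f, DThetaPMEllHT.Iso.ext' ?_ ?_⟩
  · -- the `𝒟-Θ^±`-bridge part
    exact DThetaPMBridge.Iso.ext' rfl (heq_of_eq hcapsF) hcod'.symm
  · -- the `𝒟-Θ^{ell}`-bridge part
    exact DThetaEllBridge.Iso.ext' rfl (heq_of_eq hcapsF) hglob.symm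

/-- **IUTchI:Def6.4(iii)** (kurims p.163) Hence the printed isomorphisms of `𝒟-Θ^{±ell}`-Hodge theaters
`†ℋ𝒯 ⥲ ‡ℋ𝒯` are EXACTLY the images `f.toIso` of the representatives `f : DRepIso †ℋ𝒯 ‡ℋ𝒯` (existence form).
[claim: Mochizuki2012, status: disputed] -/
theorem exists_toIso_eq (I : DThetaPMEllHT.Iso H₁ H₂) : ∃ f : DRepIso H₁ H₂, f.toIso = I :=
  toIso_surjective I

/-- **IUTchI:Def6.4(iii)** (kurims p.163) **The fibres of `toIso`**: two representatives determine the SAME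
printed isomorphism of `𝒟-Θ^{±ell}`-Hodge theaters iff they have the same index bijection `T ⥲ T'`, their
`†𝔇_≻ ⥲ ‡𝔇_≻` lie in the same `Aut_+(‡𝔇_≻)`-orbit ("`+`-full poly-isomorphism", Def 6.1 (iv) p.157 — compared
through the induced bijections of `±`-label classes), and their `†𝒟^{⊚±} ⥲ ‡𝒟^{⊚±}` lie in the same
`Aut_csp(‡𝒟^{⊚±})`-orbit (Def 6.4 (ii) p.163); the capsule constituents are then forced (abc-iut-L5-t13's
rigidity, `toPMIso_eq_iff`). Together with `toIso_surjective`: printed isomorphisms = representatives modulo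
this relation. [claim: Mochizuki2012, status: disputed] -/
theorem toIso_eq_toIso_iff (f g : DRepIso H₁ H₂) :
    f.toIso = g.toIso ↔ f.ι = g.ι ∧ (∀ v, K.labMap v (f.cod v) = K.labMap v (g.cod v)) ∧
      ∃ c ∈ K.autCsp H₂.glob, g.glob = f.glob ≪≫ c := by
  have h1 : (1 : Aut H₂.glob) = Iso.refl _ := rfl
  constructor
  · intro h
    have hpm : f.toPMIso = g.toPMIso := congrArg DThetaPMEllHT.Iso.pmIso h
    have hell : f.toEllIso = g.toEllIso := congrArg DThetaPMEllHT.Iso.ellIso h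
    obtain ⟨hι, hcod⟩ := (toPMIso_eq_iff f g).mp hpm
    refine ⟨hι, hcod, ?_⟩
    have hG : g.glob ∈ f.toEllIso.globPoly := by
      rw [hell]
      exact ⟨1, one_mem _, by rw [h1, Iso.trans_refl]⟩
    obtain ⟨c, hc, hgc⟩ := hG
    exact ⟨c, hc, hgc⟩
  · rintro ⟨hι, hcod, c, hc, hgc⟩
    have hpm : f.toPMIso = g.toPMIso := (toPMIso_eq_iff f g).mpr ⟨hι, hcod⟩
    refine DThetaPMEllHT.Iso.ext' hpm (DThetaEllBridge.Iso.ext' hι ?_ ?_)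
    · change HEq f.toPMIso.capsPoly g.toPMIso.capsPoly
      rw [hpm]
    · show {ψ | ∃ c ∈ K.autCsp H₂.glob, ψ = f.glob ≪≫ c} = {ψ | ∃ c ∈ K.autCsp H₂.glob, ψ = g.glob ≪≫ c}
      have hfg : f.glob = g.glob ≪≫ c.symm := by rw [hgc, Iso.trans_assoc, Iso.self_symm_id, Iso.trans_refl]
      ext ψ
      simp only [Set.mem_setOf_eq]
      constructor
      · rintro ⟨c', hc', rfl⟩
        refine ⟨c' * c⁻¹, mul_mem hc' (inv_mem hc), ?_⟩
        rw [Aut.Aut_mul_def, Aut.Aut_inv_def, hfg, Iso.trans_assoc]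
      · rintro ⟨c', hc', rfl⟩
        refine ⟨c' * c, mul_mem hc' hc, ?_⟩
        rw [Aut.Aut_mul_def, hgc, Iso.trans_assoc]

end DHTRep.DRepIso

end Literature.IUT.LogThetaLattice
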